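import Summits.ResolutionOfSingularities.KangarooAtlas.MizutaniExtremalTypeAll
import Summits.ResolutionOfSingularities.KangarooAtlas.MizutaniCoordChange
import HarnessLib

/-!
# Mizutani's Thm. 2.8, second part, as a CHARACTERISATION: a point is extremal iff it is of the type of Example 2.1

Cell `pub-rosobs`, Mizutani enclosure (seat mizutani-encloser-2, gen 8). AI-written; AI review is weaker than expert review;
NOT a resolution-of-singularities theorem (summit relevance C).

Mizutani (Nagoya Math. J. 52 (1973)): Example 2.1 — for a `p`-independent pair `c₁, c₂` the pair `(k·f, W)`, `f = Σ_{i<p} c₁^i (X_i + c₂ Z_i)`,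
«is an H-scheme of exponent `e(H) = 1` and `dim H = 2p − 1` … the most typical example of those H-schemes which are not vector groups and
associated with a closed point in `ℙ^{2p−1}`»; Thm. 2.8 (second part) — conversely every `H` with `dim H = 2p − 1`, not a vector group,
`V ∩ W = {0}`, «is of the same type as Example 2.1».  In the tree the forward direction is `span_coords_eq_of_extremal_all`
(`MizutaniExtremalTypeAll.lean`: the point is `[c^{1/p}]` with `span_{k^p}{c_i} = k^p(c₀') ⊕ k^p(c₀')c₁'` inside `k^p(y_1, y_2)`) and the
attained point `GenAtt.attP k p 1 u = [ (u_0^ε u_1^j)^{1/p} ]` has exponent `1`, `dim + 1 = 2p`, one invariant form (`MizutaniNumber`,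
`MizutaniAttainedGeneralForms`).  This file closes the circle with the `GL_{n+1}(k)`-equivariance of `MizutaniCoordChange.lean`:

* `comap_aeval_linForm_ratPoint` — `σ_M^{-1}([c^{1/q}]) = [(M^{[q]} c)^{1/q}]`: projective coordinate changes act on the `k^{1/q}`-rational
  points through the twisted matrix `M^{[q]}`;
* `pIndep_of_isRootTower` — a root-tower presentation `c'` of `k^{q}(y)` is a `p`-independent family of `k`; `pIndep_swap`;
* `exists_pIndep_span_eq_of_extremal` — the forward direction read in `k`: an extremal point is `[c^{1/p}]` with
  `span_{k^p}{c_i} = span_{k^p}{y₀^m y₁^j : m < p, j ≤ 1}` for a `p`-INDEPENDENT PAIR `(y₀, y₁)` of `k`;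
* **`extremal_of_span_eq`** — THE CONVERSE: if `c : Fin 2p → k` is a `k^p`-basis of `span_{k^p}{y₀^m y₁^j : m < p, j ≤ 1}` for a
  `p`-independent pair, then `[c^{1/p}]` is a point of `ℙ^{2p−1}_k` with no linear form through it, exponent `1`, ONE invariant form of
  level one and `dim B + 1 = 2p` — it is a projective transform `σ_M^{-1}(attP)` of the attained point (`M^{[p]}` = the `k^p`-base change,
  invertible because both families are `k^p`-bases);
* **`extremal_iff_type`** — THM. 2.8, SECOND PART, AS AN IFF: a homogeneous prime `𝔭 ⊂ k[X_0..X_n]` is an extremal point (a point, no linear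
  form, `(L_B)_1 ≠ 0`, `n + 2 = 2p + dim (L_B)_1`) iff `n + 1 = 2p` and `𝔭 = [c^{1/p}]` for a `k^p`-basis `c` of some
  `k^p(y₀) ⊕ k^p(y₀)·y₁`, `(y₀, y₁)` `p`-independent — «the type of Example 2.1» is exactly the extremal type.

## References

* H. Mizutani, *Hironaka's additive group schemes*, Nagoya Math. J. 52 (1973) 85–95, Example 2.1, p. 87 (type), Thm. 2.8.
  [Mizutani1973HironakaGroupSchemes]
-/

noncomputable section

open MvPolynomial Literature.AlgebraicGeometry.Resolution Literature.AlgebraicGeometry.Resolution.HironakaScheme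
open Literature.RingTheory.MvPolynomial

namespace Summit.ResolutionOfSingularities.KangarooAtlas.Mizutani

universe u

/-! ## Coordinate changes act on rational points through `M^{[q]}` -/

section RatPointChange

variable (k : Type u) [Field k] (p : ℕ) [hp : Fact p.Prime] [CharP k p] {n : ℕ}
  (M : Matrix (Fin (n + 1)) (Fin (n + 1)) k)

/-- **`σ_M^{-1}([c'^{1/q}]) = [(M^{[q]} c')^{1/q}]`**: the pull-back of the `k^{1/q}`-rational point of `c'` along `X_j ↦ Σ_i M_{ji} X_i` is the
`k^{1/q}`-rational point of `M^{[q]} *ᵥ c'` (`ψ_{c'} ∘ σ_M = ψ_{M^{[q]} c'}` on `C` and on the `X_j`).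
[cite: Oda1983HironakaGroupSchemeII, Thm. 3.1 (p. 1173: the point attached to φ)] -/
theorem comap_aeval_linForm_ratPoint (e : ℕ) (c' : Fin (n + 1) → k) :
    (ratPoint k p e c').comap (aeval fun j => linForm (M j)) = ratPoint k p e ((M.map fun x => x ^ p ^ e).mulVec c') := by
  have key : (ratPsi k p e c').comp (aeval fun j => linForm (M j)).toRingHom =
      ratPsi k p e ((M.map fun x => x ^ p ^ e).mulVec c') := by
    refine MvPolynomial.ringHom_ext (fun a => ?_) (fun j => ?_)
    · show ratPsi k p e c' (aeval (fun j => linForm (M j)) (C a)) = _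
      rw [aeval_C, MvPolynomial.algebraMap_eq]
      unfold ratPsi
      rw [eval₂Hom_C, eval₂Hom_C]
    · show ratPsi k p e c' (aeval (fun j => linForm (M j)) (X j)) = _
      rw [aeval_X, linForm_apply, map_sum, ratPsi_X, Matrix.mulVec, dotProduct, map_sum, Finset.sum_mul]
      refine Finset.sum_congr rfl fun i _ => ?_
      rw [smul_eq_C_mul, map_mul, ratPsi_X, Matrix.map_apply, map_mul, ← mul_assoc]
      congr 1
      unfold ratPsi
      rw [eval₂Hom_C, RingHom.comp_apply, iterateFrobenius_def]
  ext f
  show f ∈ Ideal.comap _ (RingHom.ker _) ↔ f ∈ RingHom.ker _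
  rw [Ideal.mem_comap, RingHom.mem_ker, RingHom.mem_ker, ← key]
  rfl

end RatPointChange

/-! ## Root-tower presentations are `p`-independent families -/

section PIndepTransfer

variable {k : Type u} [Field k] {p : ℕ} [hp : Fact p.Prime] [CharP k p]

/-- **A root-tower presentation of an intermediate field is `p`-independent**: if `F ⊆ k` is a root tower over `k^{p^e}` on generators
`a : Fin s → F` (`IsRootTower (k^{p^e}) F (p^e) x a`), then the box monomials `a^W`, `W ∈ [0, p^e)^s`, are `k^{p^e}`-linearly independent in `k`
(they span `F`, of dimension `(p^e)^s`). [cite: Mizutani1973HironakaGroupSchemes, Lemma 2.4 (p. 88: p-independent generators of K = k^q(c_1, …, c_m))] -/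
theorem pIndep_of_isRootTower {e s : ℕ} {F : IntermediateField (frobPow k p e) k} {x : Fin s → frobPow k p e} {a : Fin s → F}
    (h : IsRootTower (frobPow k p e) F (p ^ e) x a) : PIndep p e (fun i => (a i : k)) := by
  classical
  haveI := h.finiteDimensional
  set v : (Fin s → Fin (p ^ e)) → F := fun W => ∏ i, a i ^ ((W i : ℕ)) with hv
  have hsp : ⊤ ≤ Submodule.span (frobPow k p e) (Set.range v) := by
    intro z _
    refine Submodule.span_mono ?_ (h.mem_span z)
    rintro _ ⟨W, hW, rfl⟩
    exact ⟨fun i => ⟨W i, hW i⟩, rfl⟩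
  have hcard : Fintype.card (Fin s → Fin (p ^ e)) = Module.finrank (frobPow k p e) F := by
    rw [Fintype.card_fun, Fintype.card_fin, Fintype.card_fin, h.finrank_eq]
  have hli := linearIndependent_of_top_le_span_of_card_eq_finrank hsp hcard
  have hmap := hli.map' ((F.val.toLinearMap).restrictScalars (frobPow k p e)) (LinearMap.ker_eq_bot.mpr F.val.injective)
  have heq : (fun W : Fin s → Fin (p ^ e) => fmon (fun i => (a i : k)) W) =
      ((F.val.toLinearMap).restrictScalars (frobPow k p e)) ∘ v := by
    funext W
    simp only [Function.comp_apply, LinearMap.restrictScalars_apply, AlgHom.toLinearMap_apply, hv, fmon, map_prod,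
      map_pow, IntermediateField.coe_val]
  show LinearIndependent (frobPow k p e) fun W : Fin s → Fin (p ^ e) => fmon (fun i => (a i : k)) W
  rw [heq]
  exact hmap

/-- `p`-independence is invariant under permuting the family. [folklore] -/
theorem PIndep.comp_equiv {j s : ℕ} {b : Fin s → k} (hb : PIndep p j b) (σ : Fin s ≃ Fin s) : PIndep p j (b ∘ σ) := by
  have heq : (fun W : Fin s → Fin (p ^ j) => fmon (b ∘ σ) W) =
      (fun W : Fin s → Fin (p ^ j) => fmon b W) ∘ fun W => W ∘ σ.symm := by
    funext W
    simp only [Function.comp_apply, fmon]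
    exact (Fintype.prod_equiv σ (fun i => b (σ i) ^ (W i : ℕ)) (fun i => b i ^ ((W (σ.symm i)) : ℕ))
      fun i => by rw [Equiv.symm_apply_apply])
  show LinearIndependent (frobPow k p j) fun W : Fin s → Fin (p ^ j) => fmon (b ∘ σ) W
  rw [heq]
  exact hb.comp _ fun W W' h => by
    have := congrArg (fun V : Fin s → Fin (p ^ j) => V ∘ σ) h
    simpa [Function.comp_def] using this

/-- Swapping a `p`-independent pair. [folklore] -/
theorem pIndep_swap {j : ℕ} {y : Fin 2 → k} (hy : PIndep p j y) : PIndep p j ![y 1, y 0] := by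
  have h : (![y 1, y 0] : Fin 2 → k) = y ∘ Equiv.swap 0 1 := by
    funext i
    fin_cases i <;> simp [Equiv.swap_apply_left, Equiv.swap_apply_right]
  rw [h]
  exact hy.comp_equiv _

end PIndepTransfer

/-! ## The forward direction read in `k` -/

section Forward

variable (k : Type u) [Field k] (p : ℕ) [hp : Fact p.Prime] [CharP k p] {n : ℕ}
  (𝔭 : Ideal (MvPolynomial (Fin (n + 1)) k))

/-- **Thm. 2.8, second part, read in `k`**: an extremal point is `[c^{1/p}]` (`c_0 = 1`, `c` `k^p`-independent) with
`span_{k^p}{c_i} = span_{k^p}{y₀^m y₁^j : m < p, j ≤ 1} = k^p(y₀) ⊕ k^p(y₀)·y₁` for a `p`-INDEPENDENT PAIR `(y₀, y₁)` of `k`.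
[cite: Mizutani1973HironakaGroupSchemes, Thm. 2.8 (second part)] -/
theorem exists_pIndep_span_eq_of_extremal (hP : IsPoint k 𝔭) (h0 : invForms k p 𝔭 0 = ⊥) (hV : invForms k p 𝔭 1 ≠ ⊥)
    (hdim : n + 2 = 2 * p + Module.finrank k (invForms k p 𝔭 1)) :
    n + 1 = 2 * p ∧ ∃ (c : Fin (n + 1) → k) (y : Fin 2 → k), c 0 = 1 ∧ LinearIndependent (frobPow k p 1) c ∧
      𝔭 = ratPoint k p 1 c ∧ PIndep p 1 y ∧
      Submodule.span (frobPow k p 1) (Set.range c) =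
        Submodule.span (frobPow k p 1) (Set.range fun mj : Fin p × Fin 2 => y 0 ^ (mj.1 : ℕ) * y 1 ^ (mj.2 : ℕ)) := by
  obtain ⟨hn, c, y, hy, hc, x', c', h', hc0, hcind, heq, -, hspan⟩ := span_coords_eq_of_extremal_all k p 𝔭 hP h0 hV hdim
  refine ⟨hn, c, fun i => (c' i : k), hc0, hcind, heq, pIndep_of_isRootTower h', ?_⟩
  set ρ := ((towerField 1 y).val.toLinearMap).restrictScalars (frobPow k p 1) with hρ
  have h := congrArg (Submodule.map ρ) hspan
  rw [Submodule.map_span, Submodule.map_span, ← Set.range_comp, ← Set.range_comp] at h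
  have h1 : (ρ ∘ fun i => (⟨c i, hc i⟩ : towerField 1 y)) = c := funext fun i => rfl
  have h2 : (ρ ∘ fun mj : Fin p × Fin 2 => c' 0 ^ (mj.1 : ℕ) * c' 1 ^ (mj.2 : ℕ)) =
      fun mj : Fin p × Fin 2 => (c' 0 : k) ^ (mj.1 : ℕ) * (c' 1 : k) ^ (mj.2 : ℕ) := by
    funext mj
    simp only [hρ, Function.comp_apply, LinearMap.restrictScalars_apply, AlgHom.toLinearMap_apply, map_mul, map_pow,
      IntermediateField.coe_val]
  rw [h1, h2] at h
  exact h

end Forward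

/-! ## The converse: every point of the type of Example 2.1 is extremal -/

section Converse

variable (k : Type u) [Field k] (p : ℕ) [hp : Fact p.Prime] [CharP k p]

omit [CharP k p] in
/-- The coordinates of the attained point `attP k p 1 u`, `u = (y₁, y₀)`, are the monomials `y₀^m y₁^j` (`m < p`, `j ≤ 1`). [cite: Mizutani1973HironakaGroupSchemes, Example 2.1 and Remark 2.10] -/
theorem range_attC_swap (y : Fin 2 → k) :
    Set.range (GenAtt.attC k p 1 ![y 1, y 0]) =
      Set.range fun mj : Fin p × Fin 2 => y 0 ^ (mj.1 : ℕ) * y 1 ^ (mj.2 : ℕ) := by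
  have hC : ∀ i, GenAtt.attC k p 1 ![y 1, y 0] i = y 0 ^ ((attIdx p 1 i).2 : ℕ) * y 1 ^ ((attIdx p 1 i).1 : ℕ) := by
    intro i
    unfold GenAtt.attC
    rw [Fin.prod_univ_two, attW_zero, attW_one, mul_comm]
    rfl
  ext z
  constructor
  · rintro ⟨i, rfl⟩
    exact ⟨(Fin.cast (pow_one p) (attIdx p 1 i).2, (attIdx p 1 i).1), by rw [hC]; rfl⟩
  · rintro ⟨⟨m, j⟩, rfl⟩
    refine ⟨(attIdx p 1).symm (j, Fin.cast (pow_one p).symm m), ?_⟩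
    rw [hC, Equiv.apply_symm_apply]
    rfl

/-- **THE CONVERSE OF THM. 2.8's SECOND PART: every point of the type of Example 2.1 is extremal.**  Let `(y₀, y₁)` be a `p`-independent pair
of `k` and `c : Fin 2p → k` a `k^p`-BASIS of `k^p(y₀) ⊕ k^p(y₀)·y₁ = span_{k^p}{y₀^m y₁^j : m < p, j ≤ 1}`.  Then `[c^{1/p}]` is a point of
`ℙ^{2p−1}_k` through which no linear form passes, whose Hironaka scheme has exponent `1`, exactly ONE invariant additive form of level one
(`dim_k (L_B)_1 = 1`) and `dim B + 1 = 2p`: it is the projective transform `σ_M^{-1}(attP)` of the attained point by the `p`-th root `M` of the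
`k^p`-base change `M^{[p]}` from `(y₀^m y₁^j)` to `c` (invertible since both families are `k^p`-bases), and the dictionary is
`GL_{2p}(k)`-equivariant (`MizutaniCoordChange.lean`).
[cite: Mizutani1973HironakaGroupSchemes, Example 2.1 («e(H) = 1 and dim H = 2p − 1»), p. 87 (type), Thm. 2.8] -/
theorem extremal_of_span_eq {y : Fin 2 → k} (hy : PIndep p 1 y) {c : Fin (attN p 1 + 1) → k}
    (hc : LinearIndependent (frobPow k p 1) c)
    (hspan : Submodule.span (frobPow k p 1) (Set.range c) =
      Submodule.span (frobPow k p 1) (Set.range fun mj : Fin p × Fin 2 => y 0 ^ (mj.1 : ℕ) * y 1 ^ (mj.2 : ℕ))) :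
    IsPoint k (ratPoint k p 1 c) ∧ invForms k p (ratPoint k p 1 c) 0 = ⊥ ∧ exponent k p (ratPoint k p 1 c) = 1 ∧
      Module.finrank k (invForms k p (ratPoint k p 1 c) 1) = 1 ∧ hsDim k p (ratPoint k p 1 c) + 1 = 2 * p := by
  classical
  set u : Fin 2 → k := ![y 1, y 0] with hu_def
  have hu : PIndep p 1 u := pIndep_swap hy
  set v := GenAtt.attC k p 1 u with hv
  have hspan' : Submodule.span (frobPow k p 1) (Set.range c) = Submodule.span (frobPow k p 1) (Set.range v) := by
    rw [hspan, hv, hu_def, range_attC_swap]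
  -- the `k^p`-base change `N` with `c_j = Σ_i N_{ji} v_i`, and its `p`-th root `M`
  have hmem : ∀ j, c j ∈ Submodule.span (frobPow k p 1) (Set.range v) := fun j =>
    hspan' ▸ Submodule.subset_span ⟨j, rfl⟩
  choose N hN using fun j => (Submodule.mem_span_range_iff_exists_fun (frobPow k p 1)).mp (hmem j)
  have hroot : ∀ j i, ∃ m : k, m ^ p ^ 1 = (N j i : k) := fun j i => mem_frobPow_iff.mp (N j i).2
  choose m hm using hroot
  set M : Matrix (Fin (attN p 1 + 1)) (Fin (attN p 1 + 1)) k := Matrix.of m with hM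
  have hMmap : (M.map fun x => x ^ p ^ 1) = (frobPow k p 1).subtype.mapMatrix (Matrix.of N) := by
    ext j i
    rw [Matrix.map_apply, hM, Matrix.of_apply, hm, RingHom.mapMatrix_apply, Matrix.map_apply, Matrix.of_apply,
      Subfield.coe_subtype]
  have hc_eq : (M.map fun x => x ^ p ^ 1).mulVec v = c := by
    funext j
    rw [Matrix.mulVec, dotProduct, ← hN j]
    refine Finset.sum_congr rfl fun i _ => ?_
    rw [Matrix.map_apply, hM, Matrix.of_apply, hm, Subfield.smul_def, smul_eq_mul]
  -- `N` (hence `M`) is invertible: `c` is `k^p`-independent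
  have hdetN : (Matrix.of N).det ≠ 0 := by
    intro h0
    obtain ⟨w, hw0, hw⟩ := Matrix.exists_vecMul_eq_zero_iff.mpr h0
    apply hw0
    have hsum : ∑ j, w j • c j = 0 := by
      calc ∑ j, w j • c j = ∑ j, w j • ∑ i, N j i • v i := by simp_rw [hN]
        _ = ∑ i, (Matrix.vecMul w (Matrix.of N)) i • v i := by
            simp_rw [Finset.smul_sum, smul_smul]
            rw [Finset.sum_comm]
            refine Finset.sum_congr rfl fun i _ => ?_
            rw [Matrix.vecMul, dotProduct, Finset.sum_smul]
            rfl
        _ = 0 := by rw [hw]; simp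
    exact funext fun j => Fintype.linearIndependent_iff.mp hc w hsum j
  have hdet : IsUnit M.det := by
    rw [isUnit_iff_ne_zero]
    intro h0
    apply hdetN
    have h2 : (M.map fun x => x ^ p ^ 1) = (iterateFrobenius k p 1).mapMatrix M := by
      ext j i; rw [RingHom.mapMatrix_apply, Matrix.map_apply, Matrix.map_apply, iterateFrobenius_def]
    have h1 : (M.map fun x => x ^ p ^ 1).det = 0 := by
      rw [h2, ← RingHom.map_det, h0, map_zero]
    rw [hMmap, ← RingHom.map_det] at h1
    exact (map_eq_zero_iff _ (frobPow k p 1).subtype_injective).mp h1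
  -- the point is a projective transform of the attained point
  have hP : ratPoint k p 1 c = (GenAtt.attP k p 1 u).comap (aeval fun j => linForm (M j)) := by
    rw [GenAtt.attP_eq_ratPoint, comap_aeval_linForm_ratPoint, ← hv, hc_eq]
  have hc0 : c ≠ 0 := fun h => hc.ne_zero 0 (congr_fun h 0)
  refine ⟨isPoint_ratPoint hc0, invForms_ratPoint_zero_eq_bot hc, ?_, ?_, ?_⟩
  · rw [hP, exponent_comap k p hdet]
    exact GenAtt.exponent_attP hu le_rfl
  · rw [hP, finrank_invForms_comap k p hdet]
    exact GenAtt.finrank_invForms_attP hu le_rfl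
  · rw [hP, hsDim_comap k p hdet]
    have h := GenAtt.hsDim_attP (k := k) hu (le_refl 1)
    rwa [pow_one] at h

end Converse

/-! ## Thm. 2.8, second part, as an iff -/

section Iff

variable (k : Type u) [Field k] (p : ℕ) [hp : Fact p.Prime] [CharP k p] {n : ℕ}
  (𝔭 : Ideal (MvPolynomial (Fin (n + 1)) k))

/-- **THM. 2.8, SECOND PART, AS A CHARACTERISATION OF THE EXTREMAL TYPE.**  For a homogeneous ideal `𝔭 ⊂ k[X_0, …, X_n]` the following are
equivalent: (i) `𝔭` is an EXTREMAL point — a point of `ℙ^n_k` with no linear form through it, not a vector group at level one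
(`(L_B)_1 ≠ 0`) and `dim B(𝔭) + 1 = 2p` read at level one (`n + 2 = 2p + dim_k (L_B)_1`); (ii) `n + 1 = 2p` and `𝔭 = [c^{1/p}]` for a
`k^p`-basis `c` of `k^p(y₀) ⊕ k^p(y₀)·y₁` with `(y₀, y₁)` a `p`-independent pair of `k` — «the same type as Example 2.1».
[cite: Mizutani1973HironakaGroupSchemes, Example 2.1 and Thm. 2.8 (second part)] -/
theorem extremal_iff_type :
    (IsPoint k 𝔭 ∧ invForms k p 𝔭 0 = ⊥ ∧ invForms k p 𝔭 1 ≠ ⊥ ∧ n + 2 = 2 * p + Module.finrank k (invForms k p 𝔭 1)) ↔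
    (n + 1 = 2 * p ∧ ∃ (c : Fin (n + 1) → k) (y : Fin 2 → k), LinearIndependent (frobPow k p 1) c ∧ PIndep p 1 y ∧
      𝔭 = ratPoint k p 1 c ∧ Submodule.span (frobPow k p 1) (Set.range c) =
        Submodule.span (frobPow k p 1) (Set.range fun mj : Fin p × Fin 2 => y 0 ^ (mj.1 : ℕ) * y 1 ^ (mj.2 : ℕ))) := by
  constructor
  · rintro ⟨hP, h0, hV, hdim⟩
    obtain ⟨hn, c, y, -, hcind, heq, hy, hspan⟩ := exists_pIndep_span_eq_of_extremal k p 𝔭 hP h0 hV hdim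
    exact ⟨hn, c, y, hcind, hy, heq, hspan⟩
  · rintro ⟨hn, c, y, hcind, hy, heq, hspan⟩
    have hn' : n = attN p 1 := by
      have := attN_succ p 1
      rw [pow_one] at this
      omega
    subst hn'
    obtain ⟨hP, h0, -, hfr, -⟩ := extremal_of_span_eq k p hy hcind hspan
    rw [heq]
    refine ⟨hP, h0, ?_, ?_⟩
    · intro h
      rw [h, finrank_bot] at hfr
      exact zero_ne_one hfr
    · rw [hfr]
      have := attN_succ p 1
      rw [pow_one] at this
      omega

end Iff

end Summit.ResolutionOfSingularities.KangarooAtlas.Mizutani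

end
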